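import Literature.AnabelianGeometry.AbsoluteAnabelian.AbsTopICharacterRankProofs
import Literature.AnabelianGeometry.AbsoluteAnabelian.AbsTopICuspidalDecompositionSub
import HarnessLib

/-!
# [AbsTopI] Lemma 4.5 (iii): the typed predicates depend only on the ISOMORPHISM CLASS of the
# `G`-module `V` and on the POWER-EQUIVALENCE CLASS of `χ^{cyclo}` (proof-only)

Proof-only companion of `AbsTopICharacterRank.lean` (S. Mochizuki, *Topics in Absolute Anabelian
Geometry I: Generalities* [MochizukiAbsTopI2012], Lemma 4.5 (ii)/(iii), kurims manuscript p. 54) and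
of the statements-first sub-DAG `AbsTopICuspidalDecompositionSub.lean`.  Cell abc-iut, block F, seat
abc-iut-f-062 (FACT-LIST rows F-0222 `Lem45iii_cuspCount`, F-0223 `Lem45iii_cycloClass`, F-0224
`Lem45iii_det`, F-0225 `RealisedWeight`).

Typing policy θ of the trunk makes `V = H^{ab} ⊗ ℚ_l` and `χ^{cyclo}` INPUT DATA to be supplied by a
model — a model can only ever supply `V` up to a `G`-equivariant `K`-linear isomorphism, and print
treats characters "up to power-equivalence" throughout Lemma 4.5 ((ii): "`d_χ(M)` … depends only on
the power-equivalence class of `χ`"; (iii): "the power-equivalence class of the cyclotomic character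
`χ^{cyclo}_G` may be characterized as …").  This file certifies in the kernel that every predicate of
(iii) and every sub-DAG input is WELL DEFINED on these classes:

* along an intertwining `e : V ≃ₗ[K] V'` (`e ∘ ρ(g) = ρ'(g) ∘ e`): `detChar_eq_of_equivariant`,
  `realisedWeight_iff_of_equivariant`, `lem45iii_det_iff_of_equivariant`,
  `lem45iii_cycloClass_iff_of_equivariant`, `lem45iii_cuspCount_iff_of_equivariant`, and for the
  [CombGC] inputs `detSqQuasiCyclotomic_iff_of_equivariant` (A3),
  `realisedWeightsSymmetric_iff_of_equivariant` (A7), `cuspCountViaWeights_iff_of_equivariant` (A9);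
* under power-equivalence `χ₁ⁿ = χ₂ⁿ` (`0 < n`) of the reference character:
  `isQCyclotomicOfWeightK_iff_of_powerEquivalent` (the weight calculus `χ^b = (χ^{cyclo})^a`,
  `w = 2a/b` is insensitive: `(a, b) ↦ (na, nb)`), `realisedWeight_iff_of_powerEquivalent`,
  `lem45iii_det_iff_of_powerEquivalent`, `lem45iii_cycloClass_iff_of_powerEquivalent`, and — for
  CONTINUOUS characters into a `T₁` topological field, via the trunk's `dChi_eq_of_powerEquivalent` —
  `lem45iii_cuspCount_iff_of_powerEquivalent`.
No new definitions.  HONEST FRAMING: refereed pre-IUT anabelian geometry; bookkeeping over the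
typed predicates; nothing here bears on [IUTchIII] Cor. 3.12.
-/

noncomputable section

open scoped Classical

namespace Literature.AnabelianGeometry.AbsoluteAnabelian.AbsTopI

universe u v w' w''

/-! ## §1. Invariance along an intertwining linear equivalence `e : V ≃ V'` -/

section Equivariant

variable {G : Type u} [Group G] [TopologicalSpace G]
variable {K : Type v} [Field K]
variable {V : Type w'} [AddCommGroup V] [Module K V]
variable {V' : Type w''} [AddCommGroup V'] [Module K V']
variable {ρ : G →* (V ≃ₗ[K] V)} {ρ' : G →* (V' ≃ₗ[K] V')}

omit [TopologicalSpace G] in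
/-- An intertwining linear equivalence conjugates the acting operators: `ρ'(g) = e ∘ ρ(g) ∘ e⁻¹`.
[cite: MochizukiAbsTopI2012, Lemma 4.5 (ii) p.54] -/
theorem coe_eq_conj_of_equivariant (e : V ≃ₗ[K] V') (he : ∀ g m, e (ρ g m) = ρ' g (e m)) (g : G) :
    ((ρ' g : V' ≃ₗ[K] V') : V' →ₗ[K] V') =
      (e : V →ₗ[K] V') ∘ₗ ((ρ g : V ≃ₗ[K] V) : V →ₗ[K] V) ∘ₗ (e.symm : V' →ₗ[K] V) := by
  ext m'
  simp only [LinearEquiv.coe_coe, LinearMap.coe_comp, Function.comp_apply, he,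
    LinearEquiv.apply_symm_apply]

omit [TopologicalSpace G] in
/-- **The determinant character is an invariant of the isomorphism class of `V`.**
[cite: MochizukiAbsTopI2012, Lemma 4.5 (iii) p.54] -/
theorem detChar_eq_of_equivariant (e : V ≃ₗ[K] V') (he : ∀ g m, e (ρ g m) = ρ' g (e m)) :
    detChar ρ = detChar ρ' := by
  ext g
  show ((LinearEquiv.det (ρ g) : Kˣ) : K) = ((LinearEquiv.det (ρ' g) : Kˣ) : K)
  rw [LinearEquiv.coe_det, LinearEquiv.coe_det, coe_eq_conj_of_equivariant e he g, LinearMap.det_conj]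

omit [TopologicalSpace G] in
/-- `e ⊕ id_K` intertwines `V ⊕ K` and `V' ⊕ K` (trivial action on `K`).
[cite: MochizukiAbsTopI2012, Lemma 4.5 (iii) p.54] -/
theorem withTrivial_equivariant (e : V ≃ₗ[K] V') (he : ∀ g m, e (ρ g m) = ρ' g (e m)) (g : G)
    (x : V × K) :
    e.prodCongr (LinearEquiv.refl K K) (withTrivial ρ g x) =
      withTrivial ρ' g (e.prodCongr (LinearEquiv.refl K K) x) := by
  obtain ⟨m, c⟩ := x
  show (e (ρ g m), c) = (ρ' g (e m), c)
  rw [he]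

/-- `τ((V ⊕ K)(χ)) = τ((V' ⊕ K)(χ))` along an intertwining `e : V ≃ V'`.
[cite: MochizukiAbsTopI2012, Lemma 4.5 (iii) p.54] -/
theorem quasiTrivialRank_twist_withTrivial_eq_of_equivariant [FiniteDimensional K V]
    [FiniteDimensional K V'] (e : V ≃ₗ[K] V') (he : ∀ g m, e (ρ g m) = ρ' g (e m)) (χ : G →* Kˣ) :
    quasiTrivialRank (twist (withTrivial ρ) χ) = quasiTrivialRank (twist (withTrivial ρ') χ) :=
  quasiTrivialRank_eq_of_equivariant (e.prodCongr (LinearEquiv.refl K K))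
    (twist_equivariant _ (withTrivial_equivariant e he) χ)

/-- **F-0225 is well defined on the isomorphism class of `V`.** [cite: MochizukiAbsTopI2012, Lemma 4.5 (iii) p.54] -/
theorem realisedWeight_iff_of_equivariant [FiniteDimensional K V] [FiniteDimensional K V']
    (e : V ≃ₗ[K] V') (he : ∀ g m, e (ρ g m) = ρ' g (e m)) (χcyclo : G →* Kˣ) (w : ℚ) :
    RealisedWeight χcyclo ρ w ↔ RealisedWeight χcyclo ρ' w := by
  unfold RealisedWeight
  simp only [quasiTrivialRank_twist_withTrivial_eq_of_equivariant e he]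

omit [TopologicalSpace G] in
/-- **F-0224 is well defined on the isomorphism class of `V`.** [cite: MochizukiAbsTopI2012, Lemma 4.5 (iii) p.54] -/
theorem lem45iii_det_iff_of_equivariant (e : V ≃ₗ[K] V') (he : ∀ g m, e (ρ g m) = ρ' g (e m))
    (χcyclo : G →* Kˣ) : Lem45iii_det χcyclo ρ ↔ Lem45iii_det χcyclo ρ' := by
  unfold Lem45iii_det
  rw [detChar_eq_of_equivariant e he]

/-- **F-0223 is well defined on the isomorphism class of `V`.** [cite: MochizukiAbsTopI2012, Lemma 4.5 (iii) p.54] -/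
theorem lem45iii_cycloClass_iff_of_equivariant [FiniteDimensional K V] [FiniteDimensional K V']
    (e : V ≃ₗ[K] V') (he : ∀ g m, e (ρ g m) = ρ' g (e m)) (χcyclo : G →* Kˣ) :
    Lem45iii_cycloClass χcyclo ρ ↔ Lem45iii_cycloClass χcyclo ρ' := by
  unfold Lem45iii_cycloClass
  have hset : {w : ℚ | RealisedWeight χcyclo ρ w} = {w : ℚ | RealisedWeight χcyclo ρ' w} := by
    ext w
    exact realisedWeight_iff_of_equivariant e he χcyclo w
  simp only [hset, quasiTrivialRank_twist_withTrivial_eq_of_equivariant e he]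

/-- **F-0222 is well defined on the isomorphism class of `V`** (via `dChi_eq_of_equivariant`).
[cite: MochizukiAbsTopI2012, Lemma 4.5 (iii) p.54] -/
theorem lem45iii_cuspCount_iff_of_equivariant [FiniteDimensional K V] [FiniteDimensional K V']
    (e : V ≃ₗ[K] V') (he : ∀ g m, e (ρ g m) = ρ' g (e m)) (χcyclo : G →* Kˣ) (numCusps : ℕ) :
    Lem45iii_cuspCount χcyclo ρ numCusps ↔ Lem45iii_cuspCount χcyclo ρ' numCusps := by
  unfold Lem45iii_cuspCount
  rw [dChi_eq_of_equivariant e he]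

/-- **Sub-node A3 is well defined on the isomorphism class of `V`.**
[cite: MochizukiCombGC2007, Prop. 2.4 (iii) p.19] [cite: MochizukiAbsTopI2012, Lemma 4.5 (iii) p.54] -/
theorem detSqQuasiCyclotomic_iff_of_equivariant [FiniteDimensional K V] [FiniteDimensional K V']
    (e : V ≃ₗ[K] V') (he : ∀ g m, e (ρ g m) = ρ' g (e m)) (χcyclo : G →* Kˣ) :
    DetSqQuasiCyclotomic χcyclo ρ ↔ DetSqQuasiCyclotomic χcyclo ρ' := by
  unfold DetSqQuasiCyclotomic
  rw [detChar_eq_of_equivariant e he, LinearEquiv.finrank_eq e]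

/-- **Sub-node A7 is well defined on the isomorphism class of `V`.**
[cite: MochizukiCombGC2007, Prop. 2.4 (vii) p.20] [cite: MochizukiAbsTopI2012, Lemma 4.5 (iii) p.54] -/
theorem realisedWeightsSymmetric_iff_of_equivariant [FiniteDimensional K V] [FiniteDimensional K V']
    (e : V ≃ₗ[K] V') (he : ∀ g m, e (ρ g m) = ρ' g (e m)) (χcyclo : G →* Kˣ) :
    RealisedWeightsSymmetric χcyclo ρ ↔ RealisedWeightsSymmetric χcyclo ρ' := by
  unfold RealisedWeightsSymmetric
  simp only [realisedWeight_iff_of_equivariant e he]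

/-- **Sub-node A9 is well defined on the isomorphism class of `V`.**
[cite: MochizukiCombGC2007, Cor. 2.7 (i) proof p.23] [cite: MochizukiAbsTopI2012, Lemma 4.5 (iii) p.54] -/
theorem cuspCountViaWeights_iff_of_equivariant [FiniteDimensional K V] [FiniteDimensional K V']
    (e : V ≃ₗ[K] V') (he : ∀ g m, e (ρ g m) = ρ' g (e m)) (χcyclo : G →* Kˣ) (numCusps : ℕ) :
    CuspCountViaWeights χcyclo ρ numCusps ↔ CuspCountViaWeights χcyclo ρ' numCusps := by
  unfold CuspCountViaWeights
  rw [quasiTrivialRank_eq_of_equivariant e (twist_equivariant e he χcyclo⁻¹),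
    quasiTrivialRank_eq_of_equivariant e he]

end Equivariant

/-! ## §2. Invariance under power-equivalence of the reference character `χ^{cyclo}` -/

section PowerEquivalent

variable {G : Type u} [Group G] [TopologicalSpace G]
variable {K : Type v} [Field K]
variable {V : Type w'} [AddCommGroup V] [Module K V]

omit [TopologicalSpace G] in
/-- The weight calculus is insensitive to power-equivalence of the reference character: if
`χ₁ⁿ = χ₂ⁿ` (`n > 0`) and `χ^b = χ₁^a`, then `χ^{nb} = χ₂^{na}` with the same weight `2a/b`.
[cite: MochizukiAbsTopI2012, Lemma 4.5 p.54] [cite: MochizukiCombGC2007, Def. 2.3 (ii) p.18] -/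
theorem isQCyclotomicOfWeightK_of_powerEquivalent {χ₁ χ₂ : G →* Kˣ} {n : ℕ} (hn : 0 < n)
    (hpow : ∀ g : G, χ₁ g ^ n = χ₂ g ^ n) {χ : G →* Kˣ} {w : ℚ}
    (h : IsQCyclotomicOfWeightK χ₁ χ w) : IsQCyclotomicOfWeightK χ₂ χ w := by
  obtain ⟨a, b, hb, hab, hw⟩ := h
  have hnz : (0 : ℤ) < n := by exact_mod_cast hn
  refine ⟨n * a, n * b, by positivity, fun g => ?_, ?_⟩
  · rw [mul_comm (n : ℤ) b, mul_comm (n : ℤ) a, zpow_mul, zpow_mul, hab g, ← zpow_mul, ← zpow_mul,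
      mul_comm a, zpow_mul, zpow_mul, zpow_natCast, zpow_natCast, hpow g]
  · rw [hw]
    have hbq : (b : ℚ) ≠ 0 := by exact_mod_cast hb.ne'
    have hnq : (n : ℚ) ≠ 0 := by exact_mod_cast hn.ne'
    push_cast
    field_simp

omit [TopologicalSpace G] in
/-- `ℚ`-cyclotomicity of a given weight depends only on the power-equivalence class of `χ^{cyclo}`.
[cite: MochizukiAbsTopI2012, Lemma 4.5 p.54] -/
theorem isQCyclotomicOfWeightK_iff_of_powerEquivalent {χ₁ χ₂ : G →* Kˣ} {n : ℕ} (hn : 0 < n)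
    (hpow : ∀ g : G, χ₁ g ^ n = χ₂ g ^ n) (χ : G →* Kˣ) (w : ℚ) :
    IsQCyclotomicOfWeightK χ₁ χ w ↔ IsQCyclotomicOfWeightK χ₂ χ w :=
  ⟨isQCyclotomicOfWeightK_of_powerEquivalent hn hpow,
    isQCyclotomicOfWeightK_of_powerEquivalent hn fun g => (hpow g).symm⟩

/-- **F-0225 depends only on the power-equivalence class of `χ^{cyclo}`.**
[cite: MochizukiAbsTopI2012, Lemma 4.5 (iii) p.54] -/
theorem realisedWeight_iff_of_powerEquivalent {χ₁ χ₂ : G →* Kˣ} {n : ℕ} (hn : 0 < n)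
    (hpow : ∀ g : G, χ₁ g ^ n = χ₂ g ^ n) (ρV : G →* (V ≃ₗ[K] V)) (w : ℚ) :
    RealisedWeight χ₁ ρV w ↔ RealisedWeight χ₂ ρV w := by
  unfold RealisedWeight
  simp only [isQCyclotomicOfWeightK_iff_of_powerEquivalent hn hpow]

omit [TopologicalSpace G] in
/-- **F-0224 depends only on the power-equivalence class of `χ^{cyclo}`.**
[cite: MochizukiAbsTopI2012, Lemma 4.5 (iii) p.54] -/
theorem lem45iii_det_iff_of_powerEquivalent {χ₁ χ₂ : G →* Kˣ} {n : ℕ} (hn : 0 < n)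
    (hpow : ∀ g : G, χ₁ g ^ n = χ₂ g ^ n) (ρV : G →* (V ≃ₗ[K] V)) :
    Lem45iii_det χ₁ ρV ↔ Lem45iii_det χ₂ ρV := by
  unfold Lem45iii_det
  simp only [isQCyclotomicOfWeightK_iff_of_powerEquivalent hn hpow]

omit [TopologicalSpace G] in
/-- Power-equivalence to `χ₁` vs to `χ₂` when `χ₁ⁿ = χ₂ⁿ`: the same classes.
[cite: MochizukiAbsTopI2012, Lemma 4.5 (ii) p.54] -/
theorem powerEquivalent_iff_of_powerEquivalent {χ₁ χ₂ : G →* Kˣ} {n : ℕ} (hn : 0 < n)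
    (hpow : ∀ g : G, χ₁ g ^ n = χ₂ g ^ n) (ψ : G →* Kˣ) :
    (∃ m : ℕ, 0 < m ∧ ∀ g : G, χ₁ g ^ m = ψ g ^ m) ↔ ∃ m : ℕ, 0 < m ∧ ∀ g : G, χ₂ g ^ m = ψ g ^ m := by
  constructor
  · rintro ⟨m, hm, h⟩
    refine ⟨n * m, Nat.mul_pos hn hm, fun g => ?_⟩
    rw [pow_mul, ← hpow g, ← pow_mul, mul_comm n m, pow_mul, h g, ← pow_mul]
  · rintro ⟨m, hm, h⟩
    refine ⟨n * m, Nat.mul_pos hn hm, fun g => ?_⟩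
    rw [pow_mul, hpow g, ← pow_mul, mul_comm n m, pow_mul, h g, ← pow_mul]

/-- **F-0223 depends only on the power-equivalence class of `χ^{cyclo}`** (both the realised-weight
sets and the concluding power-equivalence are insensitive). [cite: MochizukiAbsTopI2012, Lemma 4.5 (iii) p.54] -/
theorem lem45iii_cycloClass_iff_of_powerEquivalent [FiniteDimensional K V] {χ₁ χ₂ : G →* Kˣ} {n : ℕ}
    (hn : 0 < n) (hpow : ∀ g : G, χ₁ g ^ n = χ₂ g ^ n) (ρV : G →* (V ≃ₗ[K] V)) :
    Lem45iii_cycloClass χ₁ ρV ↔ Lem45iii_cycloClass χ₂ ρV := by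
  unfold Lem45iii_cycloClass
  have hset : {w : ℚ | RealisedWeight χ₁ ρV w} = {w : ℚ | RealisedWeight χ₂ ρV w} := by
    ext w
    exact realisedWeight_iff_of_powerEquivalent hn hpow ρV w
  simp only [hset, isQCyclotomicOfWeightK_iff_of_powerEquivalent hn hpow,
    powerEquivalent_iff_of_powerEquivalent hn hpow]

/-- **F-0222 depends only on the power-equivalence class of `χ^{cyclo}`** — for CONTINUOUS characters
into a `T₁` topological field (e.g. `ℚ_l`), where the trunk's Lemma 4.5 (ii)
`dChi_eq_of_powerEquivalent` applies. [cite: MochizukiAbsTopI2012, Lemma 4.5 (ii)(iii) p.54] -/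
theorem lem45iii_cuspCount_iff_of_powerEquivalent [FiniteDimensional K V] [IsTopologicalGroup G]
    [TopologicalSpace K] [T1Space K] [ContinuousMul K] {χ₁ χ₂ : G →* Kˣ} (hχ₁ : Continuous χ₁)
    (hχ₂ : Continuous χ₂) {n : ℕ} (hn : 0 < n) (hpow : ∀ g : G, χ₁ g ^ n = χ₂ g ^ n)
    (ρV : G →* (V ≃ₗ[K] V)) (numCusps : ℕ) :
    Lem45iii_cuspCount χ₁ ρV numCusps ↔ Lem45iii_cuspCount χ₂ ρV numCusps := by
  unfold Lem45iii_cuspCount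
  rw [dChi_eq_of_powerEquivalent ρV hχ₁ hχ₂ ⟨n, hn, hpow⟩]

end PowerEquivalent

end Literature.AnabelianGeometry.AbsoluteAnabelian.AbsTopI

end
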